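import Summits.CriticalPhenomena.PercolationContinuityZ3.Theorems.Transplant.FKDoubleFanOneSidedConeS
import HarnessLib

/-!
# Double fans `K₂ ∨ P_{m+1}`: the RELABELLING IDENTITY `P_b ∘ Comb_a(F) = P_b ∘ D ∘ (F^τ ∗ ·)`, the `y²`-term of `∧²BC_y`, and a corner tangency identity

Helper file (`--supports stmt-CriticalPhenomena-4575`), FK sub-lane `prim-bschramm-fk-3` (gen 39); builds on p205010 (kernel theorem, internal audit
signed; external expert review pending).  No named facts, no sorries; standard axioms.  Memo `bschramm/prim-bschramm-fk-3/FAR-CROSS-XIV.md` §0(B),(D).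

Pinning `b` to the new rim vertex after an `a`-gadget `F` (terminals `c_in, a, c_out`) turns the gadget into a network on the REST's terminals: with the
relabelled vector **`F^τ := (F₀, F_bc, F_ab, F_ac, F₁) = swapAB (swapAC F)`**, `BC_1 ∗ fanCombo F X = BC_1 ∗ detach (F^τ ∗ X)` (**`pinB_fanCombo`**).
Consequences: the `e_z ∧ e_v` coordinate of every `a`-image is a master form, **`(imgA q F w).zv = N^{bc}(F^τ ∗ w)`** (**`imgA_zv_eq_masterN`**; hence
`≥ 0` on `Valid × Valid` by `Valid.conv`, **`imgA_zv_nonneg_of_valid`**), i.e. `W_b (imgA F w) = N^{bc}(F^τ ∗ w)·e_zv` (**`opWb_imgA`**): the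
`y²`-term of `∧²BC_y (imgA F w)` is an explicit multiple of the input atom `e_zv`, and `HypBaS` is the statement that the `T_b`-hyperbola
`T_b a + t a + t⁻¹ N^{bc}(F^τ ∗ w) e_zv`, `t > 0`, stays in the cone.  Finally the corner TANGENCY identity of the exact criterion (`…ConeSCross`):
for the cut gadgets `F = (f₀, f_ab, 0, 0, 0)` on the `P_b`-type rests `w = (0, 0, 0, b, c)` — where every uniformly shifted target
`(T_b + C)·imgA` is a boundary point of the cone (memo XIII) — `T_b (imgA F w)` IS a derivative of atoms: the polarisation of `imgA` in the gadget
direction `G = (0, 0, f₀, 0, f_ab)` (the `Λ`-tight ray of the feasible cone at `F`), **`opTb_imgA_cut_eq_polar`**.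
[folklore]
-/

noncomputable section

namespace Summit.CriticalPhenomena.PercolationContinuityZ3.Theorems

namespace FK

namespace ThreeApex

/-- **Relabelling identity**: `BC_1 ∗ (fanCombo F X) = BC_1 ∗ detach (F^τ ∗ X)`, `F^τ = swapAB (swapAC F) = (F₀, F_bc, F_ab, F_ac, F₁)`. [folklore] -/
theorem pinB_fanCombo (q : ℝ) (F X : V5) :
    conv (edgeBC 1) (fanCombo q F X) = conv (edgeBC 1) (detach q (conv (swapAB (swapAC F)) X)) := by
  ext <;> simp only [fanCombo, conv, edgeBC, edgeAC, detach, swapAB, swapAC, V5.total] <;> ring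

/-- **The `zv`-coordinate of an `a`-image is a master form**: `(imgA q F w).zv = N^{bc}(F^τ ∗ w)`. [folklore] -/
theorem imgA_zv_eq_masterN (q : ℝ) (F w : V5) :
    (imgA q F w).zv = masterN q (swapAB (conv (swapAB (swapAC F)) w)) := by
  simp only [imgA, wedgeH, fanCombo, conv, edgeAC, detach, V5.total, hx, hy, hz, masterN, swapAB, swapAC]; ring

/-- Hence `(imgA q F w).zv ≥ 0` on `Valid × Valid` (`0 ≤ q ≤ 1`), by closure of `Valid` under relabelling and products. [folklore] -/
theorem imgA_zv_nonneg_of_valid {q : ℝ} (hq0 : 0 ≤ q) {F w : V5} (hF : Valid q F) (hw : Valid q w) :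
    0 ≤ (imgA q F w).zv := by
  rw [imgA_zv_eq_masterN]; exact (hF.swapAC.swapAB.conv hq0 hw).nBC

/-- **`W_b` of an `a`-image**: `∧²P_b (imgA F w) = N^{bc}(F^τ ∗ w) · e_zv`. [folklore] -/
theorem opWb_imgA (q : ℝ) (F w : V5) :
    opWb (imgA q F w) = Biv.smul (masterN q (swapAB (conv (swapAB (swapAC F)) w))) ⟨0, 0, 0, 0, 0, 0, 0, 0, 0, 1⟩ := by
  rw [← imgA_zv_eq_masterN]; ext <;> simp [opWb, Biv.smul]

/-- `∧²BC_y (imgA F w)` as the `T_b`-parabola: `(1−y)²·a + y(1−y)·T_b a + y²·N^{bc}(F^τ ∗ w)·e_zv`. [folklore] -/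
theorem opBC_imgA_eq_lin3 (q y : ℝ) (F w : V5) :
    opBC y (imgA q F w) = Biv.lin3 ((1 - y) ^ 2) (imgA q F w) (y * (1 - y)) (opTb (imgA q F w))
      (y ^ 2 * masterN q (swapAB (conv (swapAB (swapAC F)) w))) ⟨0, 0, 0, 0, 0, 0, 0, 0, 0, 1⟩ := by
  rw [opBC, opWb_imgA]; ext <;> simp [Biv.lin3, Biv.add, Biv.smul]

/-- **Corner tangency identity**: for the cut gadgets `F = (f₀, f_ab, 0, 0, 0)` on `P_b`-type rests `w = (0, 0, 0, b, c)`, `T_b (imgA F w)` equals the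
polarisation of `imgA` in the gadget direction `G = (0, 0, f₀, 0, f_ab)`:
`T_b (X₀ ∧ X₁) = (G·X) ∧ X₁ + X₀ ∧ (G·P_a X)` with `X₀ = F·X`, `X₁ = F·P_a X`, `X = w`. [folklore] -/
theorem opTb_imgA_cut_eq_polar (q f0 fab b c : ℝ) :
    opTb (imgA q ⟨f0, fab, 0, 0, 0⟩ ⟨0, 0, 0, b, c⟩) =
      Biv.add (wedgeH (fanCombo q ⟨0, 0, f0, 0, fab⟩ (conv (edgeAC 0) ⟨0, 0, 0, b, c⟩)) (fanCombo q ⟨f0, fab, 0, 0, 0⟩ (conv (edgeAC 1) ⟨0, 0, 0, b, c⟩)))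
        (wedgeH (fanCombo q ⟨f0, fab, 0, 0, 0⟩ (conv (edgeAC 0) ⟨0, 0, 0, b, c⟩)) (fanCombo q ⟨0, 0, f0, 0, fab⟩ (conv (edgeAC 1) ⟨0, 0, 0, b, c⟩))) := by
  ext <;> simp only [opTb, imgA, wedgeH, fanCombo, conv, edgeAC, detach, V5.total, hx, hy, hz, Biv.add] <;> ring

end ThreeApex

end FK

end Summit.CriticalPhenomena.PercolationContinuityZ3.Theorems
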